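import Mathlib.Analysis.InnerProductSpace.Projection.Basic
import HarnessLib

/-!
# Connes–Consani 2021, §6.7: restoring positivity by a rank-one form (Lemma 6.9) and the
# deduction of Lemma 6.10 — PROVED

A. Connes, C. Consani, *Weil positivity and trace formula, the archimedean place*, Selecta Math.
(N.S.) 27 (2021), Paper No. 77 = arXiv:2006.13771 [bib: `ConnesConsani2021`], §6.7 "Proof of
Theorem 1" (arXiv p. 28).  This file formalizes, with the printed proofs, the ANALYTIC ASSEMBLY that
turns the spectral data of §6 into the operator inequality behind Theorem 6.11 / eq. (4)
(`Literature.NumberTheory.ConnesConsani2021.WeilArchPositivity_soninTrace_fine`, a cited named fact of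
the tree whose printed proof is computer-assisted — see that docstring and the cell file
`HOME/lit/CC2021-RIGOUR-MAP.md` of `pub-rhdoor`):

* **Lemma 6.9** (= Lemma 42 of the arXiv text, p. 28), verbatim: "Let `ℋ` be a Hilbert space,
  `φ, ψ ∈ ℋ` be unit vectors and `P_φ` the orthogonal projection on `φ^⊥ := {ξ | ⟨φ|ξ⟩ = 0}`.  Let
  `a, b, c ∈ ℝ₊`.  Then the following quadratic form on `ℋ`,
  `B(ξ) := −b |⟨φ|ξ⟩|² + a |⟨ψ|ξ⟩|² + c ‖P_φ(ξ)‖²`,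
  is positive if and only if `a + c ≥ b` and `b(a + c) ≤ a(b + c) |⟨φ|ψ⟩|²`.  When this holds one
  has `B(ξ) ≥ ε ‖ξ‖²` for all `ξ`, where `2ε = a − b + c − ((a+b+c)² − 4a(b+c)|⟨φ|ψ⟩|²)^{1/2}`."
  Here: `rankOneForm`, `rankOneGap`, `rankOneForm_nonneg_iff` (the equivalence) and
  `rankOneGap_mul_norm_sq_le` (the bound — which the printed proof in fact gives for ALL
  `a, b, c ≥ 0`, the positivity conditions being exactly `0 ≤ ε`, `rankOneGap_nonneg_iff`).
  The printed proof reduces to the `2 × 2` matrix of `B` on `span(φ, ψ)` in the basis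
  `(φ, ψ₂/‖ψ₂‖)`, `ψ₂ = P_φ ψ`, whose trace is `a + c − b` and determinant `a|⟨φ|ψ⟩|²(b+c) − b(a+c)`,
  plus `B = B(ξ₁) + c‖ξ₂‖²` on `span(φ,ψ) ⊕ span(φ,ψ)^⊥` and `ε ≤ c`; we follow it, replacing the
  appeal to the eigenvalues of the `2 × 2` matrix by the equivalent completion of the square
  (`p X² + q Y² ≥ 2 (pq)^{1/2} X Y` with `p + q = tr − 2ε`, `pq = a²|⟨φ|ψ⟩|²‖ψ₂‖²`).
* **Lemma 6.10, the deduction** (= Lemma 43, p. 28, and the spectral decomposition displayed before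
  Lemma 6.9, p. 28 lines 13–22): from "`T = λ_max |η⟩⟨η| + R`, `R ≤ λ₂ P_η`" one gets
  `⟨ξ|(1 − T)ξ⟩ ≥ (1 − λ_max)|⟨η|ξ⟩|² + (1 − λ₂)‖P_η ξ‖²`; Lemma 6.9 with `φ = η`, `ψ = η₀`,
  `b = λ_max − 1`, `c = 1 − λ₂` gives `⟨ξ|(1 − T)ξ⟩ + a|⟨η₀|ξ⟩|² ≥ ε₂‖ξ‖²`; and `‖𝐊_I − T‖ ≤ ε₁`
  gives `⟨ξ|(1 − 𝐊_I)ξ⟩ + a|⟨η₀|ξ⟩|² ≥ (ε₂ − ε₁)‖ξ‖²`, i.e. `⟨N_I ξ|ξ⟩ ≤ γ|⟨η₀|ξ⟩|²` with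
  `N_I = −2ε′(1₊)(1 − 𝐊_I)`, `γ = 2aε′(1₊)`, as soon as `ε₁ ≤ ε₂`.  Here, for ARBITRARY bounded
  operators `K, T, R` on an inner-product space and arbitrary constants:
  `re_inner_sub_le_of_rankOne_decomposition` and `re_inner_scaled_le_of_rankOne_decomposition`.
  The printed lemma is this deduction fed with the FLOATING-POINT inputs of §6
  (`λ_max = 1.05158`, `λ₂ ≤ 0.772216`, `⟨η₀|η⟩ ≃ 0.94865`, `ε₁ ≃ 0.00122`, `a ≃ 0.064`,
  `ε₂ ≃ 0.00441`, `ε′(1₊) ≃ 22.9965`, `γ ≃ 2.94355`); we prove the deduction and, separately, the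
  exact ARITHMETIC of the printed constants (`printedConstants_posconds`: at
  `(a, b, c, |⟨η|η₀⟩|) = (0.064, 0.05158, 0.227784, 0.94865)` the two positivity conditions hold and
  `ε₂ ≥ 0.00441 > 0.00122 = ε₁`), NOT the inputs themselves (they are the uncertified numerical
  content (N2)–(N4) of the printed proof, `CC2021-RIGOUR-MAP.md` §0) and NOT the identification of
  `⟨ξ|N_I ξ⟩` with the Sonin-trace defect `E∘Q(k ∗ k*)` (Prop. 5.5, Thm. 4.7: prolate theory and the
  trace formula, absent from Mathlib).  So this file does not discharge the named fact; it certifies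
  the last analytic link of its printed proof.  No RH claim; cell `pub-rhdoor` framing: lottery
  ticket at the motivic door; RH probability negligible; consolation prizes are real (typed and, where
  tractable, PROVED skeleton of the published record).

Conventions: Mathlib's inner product `⟪x, y⟫_𝕜` is antilinear in the first slot, as CC's `⟨x|y⟩`
(eq. (8) p. 7); `|⟨φ|ξ⟩|²` is `‖⟪φ, ξ⟫_𝕜‖ ^ 2`; `P_φ = (𝕜 ∙ φ)ᗮ.starProjection`; any `RCLike` scalar
field `𝕜` (the source: a complex Hilbert space; completeness is not needed).
-/

noncomputable section

open RCLike Real Submodule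

namespace Literature.NumberTheory.ConnesConsani2021

variable (𝕜 : Type*) {E : Type*} [RCLike 𝕜] [NormedAddCommGroup E] [InnerProductSpace 𝕜 E]

open scoped InnerProductSpace

/-! ## The objects of Lemma 6.9 -/

/-- The quadratic form of Connes–Consani 2021 Lemma 6.9 (arXiv Lemma 42, p. 28):
`B(ξ) := −b |⟨φ|ξ⟩|² + a |⟨ψ|ξ⟩|² + c ‖P_φ(ξ)‖²`, `P_φ` the orthogonal projection on `φ^⊥`.
[cite: ConnesConsani2021, Lemma 6.9 §6.7 p. 28] -/
def rankOneForm (φ ψ : E) (a b c : ℝ) (ξ : E) : ℝ :=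
  -b * ‖⟪φ, ξ⟫_𝕜‖ ^ 2 + a * ‖⟪ψ, ξ⟫_𝕜‖ ^ 2 + c * ‖(𝕜 ∙ φ)ᗮ.starProjection ξ‖ ^ 2

variable {𝕜}

/-- The constant `ε` of Connes–Consani 2021 Lemma 6.9 (arXiv Lemma 42, eq. for `2ε`, p. 28):
`2ε = a − b + c − ((a + b + c)² − 4a(b + c) t²)^{1/2}` with `t = |⟨φ|ψ⟩|` — the smaller eigenvalue of
the `2 × 2` matrix of `B` on `span(φ, ψ)`. [cite: ConnesConsani2021, Lemma 6.9 §6.7 p. 28] -/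
def rankOneGap (a b c t : ℝ) : ℝ :=
  (a - b + c - Real.sqrt ((a + b + c) ^ 2 - 4 * a * (b + c) * t ^ 2)) / 2

/-! ## Real arithmetic of the `2 × 2` reduction (proof of Lemma 6.9, p. 28) -/

/-- The discriminant rewritten with `t² + β² = 1` (`β = ‖P_φ ψ‖`): the identity
`(a+b+c)² − 4a(b+c)t² − (−a+b+c)² = 4a(b+c)(1 − t²)` of the printed proof. [cite: ConnesConsani2021, Lemma 6.9 §6.7 p. 28 (proof)] -/
private theorem discr_eq (a b c t β : ℝ) (h : t ^ 2 + β ^ 2 = 1) :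
    (a + b + c) ^ 2 - 4 * a * (b + c) * t ^ 2 = (b + c - a) ^ 2 + 4 * a * (b + c) * β ^ 2 := by
  linear_combination (-(4 * a * (b + c))) * h

/-- The discriminant is nonnegative. [folklore] -/
private theorem discr_nonneg {a b c t β : ℝ} (ha : 0 ≤ a) (hb : 0 ≤ b) (hc : 0 ≤ c)
    (h : t ^ 2 + β ^ 2 = 1) : 0 ≤ (a + b + c) ^ 2 - 4 * a * (b + c) * t ^ 2 := by
  rw [discr_eq a b c t β h]; positivity

/-- `ε ≤ c` ("the inequality `ε ≤ c` which follows from" the discriminant identity, p. 28).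
[cite: ConnesConsani2021, Lemma 6.9 §6.7 p. 28 (proof)] -/
theorem rankOneGap_le {a b c t β : ℝ} (ha : 0 ≤ a) (hb : 0 ≤ b) (hc : 0 ≤ c)
    (h : t ^ 2 + β ^ 2 = 1) : rankOneGap a b c t ≤ c := by
  unfold rankOneGap
  have hle : a - b - c ≤ Real.sqrt ((a + b + c) ^ 2 - 4 * a * (b + c) * t ^ 2) :=
    (le_abs_self _).trans (Real.abs_le_sqrt (by rw [discr_eq a b c t β h]; nlinarith [mul_nonneg (mul_nonneg ha (add_nonneg hb hc)) (sq_nonneg β)]))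
  linarith

/-- Under the two positivity conditions of Lemma 6.9, `0 ≤ ε`; conversely. [cite: ConnesConsani2021, Lemma 6.9 §6.7 p. 28] -/
theorem rankOneGap_nonneg_iff {a b c t β : ℝ} (ha : 0 ≤ a) (hb : 0 ≤ b) (hc : 0 ≤ c)
    (h : t ^ 2 + β ^ 2 = 1) :
    0 ≤ rankOneGap a b c t ↔ b ≤ a + c ∧ b * (a + c) ≤ a * (b + c) * t ^ 2 := by
  have hD := discr_nonneg ha hb hc h
  set D := (a + b + c) ^ 2 - 4 * a * (b + c) * t ^ 2 with hD_def
  have hgap : rankOneGap a b c t = (a - b + c - Real.sqrt D) / 2 := rfl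
  have hs0 : 0 ≤ Real.sqrt D := Real.sqrt_nonneg _
  have hs2 : Real.sqrt D ^ 2 = D := Real.sq_sqrt hD
  rw [hgap]
  constructor
  · intro hε
    have h1 : Real.sqrt D ≤ a - b + c := by linarith
    have h2 : D ≤ (a - b + c) ^ 2 := by nlinarith
    constructor
    · linarith
    · nlinarith
  · rintro ⟨h1, h2⟩
    have h3 : D ≤ (a - b + c) ^ 2 := by nlinarith
    have h4 : Real.sqrt D ≤ a - b + c := by
      calc Real.sqrt D ≤ Real.sqrt ((a - b + c) ^ 2) := Real.sqrt_le_sqrt h3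
        _ = a - b + c := Real.sqrt_sq (by linarith)
    linarith

/-- The core inequality of the `2 × 2` reduction: with `X = |⟨φ|ξ⟩|`, `βY = |⟨ψ₂|ξ⟩|`,
`βm = Re(⟨φ|ψ⟩ \overline{⟨φ|ξ⟩} ⟨ψ₂|ξ⟩)`, `|m| ≤ tXY`, one has
`−bX² + a(t²X² + β²Y² + 2βm) + cY² ≥ ε (X² + Y²)` — the statement that the matrix
`[[a t² − b, a t β], [a t β, a β² + c]]` is `≥ ε` (completion of the square: `p + q = tr − 2ε ≥ 0`,
`pq = (a t β)²`). [cite: ConnesConsani2021, Lemma 6.9 §6.7 p. 28 (proof)] -/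
private theorem core {a b c t β X Y m : ℝ} (ha : 0 ≤ a) (hb : 0 ≤ b) (hc : 0 ≤ c) (ht : 0 ≤ t)
    (hβ : 0 ≤ β) (h : t ^ 2 + β ^ 2 = 1) (hm : |m| ≤ t * X * Y) :
    rankOneGap a b c t * (X ^ 2 + Y ^ 2)
      ≤ -b * X ^ 2 + a * (t ^ 2 * X ^ 2 + β ^ 2 * Y ^ 2 + 2 * β * m) + c * Y ^ 2 := by
  have hD := discr_nonneg ha hb hc h
  set D := (a + b + c) ^ 2 - 4 * a * (b + c) * t ^ 2 with hD_def
  have hgap : rankOneGap a b c t = (a - b + c - Real.sqrt D) / 2 := rfl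
  set s := Real.sqrt D with hs_def
  have hs0 : 0 ≤ s := Real.sqrt_nonneg _
  have hs2 : s ^ 2 = D := Real.sq_sqrt hD
  set p := a * t ^ 2 - b - (a - b + c - s) / 2 with hp_def
  set q := a * β ^ 2 + c - (a - b + c - s) / 2 with hq_def
  have hpq_sum : p + q = s := by
    simp only [hp_def, hq_def]; linear_combination a * h
  have hpq_mul : p * q = (a * t * β) ^ 2 := by
    simp only [hp_def, hq_def]
    linear_combination (-(a * b) - a * (a - b + c - s) / 2) * h + (1 / 4 : ℝ) * hs2
  have hp : 0 ≤ p := by nlinarith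
  have hq : 0 ≤ q := by nlinarith
  have hsqrt : Real.sqrt p * Real.sqrt q = a * t * β := by
    rw [← Real.sqrt_mul hp, hpq_mul, Real.sqrt_sq (by positivity)]
  have e1X : Real.sqrt p ^ 2 * X ^ 2 = p * X ^ 2 := by rw [Real.sq_sqrt hp]
  have e2Y : Real.sqrt q ^ 2 * Y ^ 2 = q * Y ^ 2 := by rw [Real.sq_sqrt hq]
  have e3 : Real.sqrt p * Real.sqrt q * (X * Y) = a * t * β * (X * Y) := by rw [hsqrt]
  have key : 2 * (a * t * β) * (X * Y) ≤ p * X ^ 2 + q * Y ^ 2 := by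
    nlinarith [sq_nonneg (Real.sqrt p * X - Real.sqrt q * Y), e1X, e2Y, e3]
  have hm' : -(t * X * Y) ≤ m := (abs_le.1 hm).1
  have haβ : 0 ≤ a * β := mul_nonneg ha hβ
  have hexp : -b * X ^ 2 + a * (t ^ 2 * X ^ 2 + β ^ 2 * Y ^ 2 + 2 * β * m) + c * Y ^ 2
      - rankOneGap a b c t * (X ^ 2 + Y ^ 2) = p * X ^ 2 + q * Y ^ 2 + 2 * (a * β) * m := by
    rw [hgap]; simp only [hp_def, hq_def]; ring
  nlinarith [mul_le_mul_of_nonneg_left hm' haβ]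

/-! ## Hilbert-space bookkeeping for a unit vector `φ` -/

section UnitVector

variable {φ : E}

/-- `P_φ ξ = ξ − ⟨φ|ξ⟩ φ` for a unit vector `φ` (the printed proof's "orthogonal decomposition
`ξ = P_φ(ξ) + φ⟨φ|ξ⟩`", p. 28; standard API). [folklore] -/
private theorem starProjection_orthogonal_singleton_apply (hφ : ‖φ‖ = 1) (ξ : E) :
    (𝕜 ∙ φ)ᗮ.starProjection ξ = ξ - ⟪φ, ξ⟫_𝕜 • φ := by
  rw [starProjection_orthogonal_val, starProjection_unit_singleton 𝕜 hφ]

/-- Pythagoras: `‖P_φ ξ‖² = ‖ξ‖² − |⟨φ|ξ⟩|²` for a unit vector `φ` (standard API). [folklore] -/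
private theorem norm_sq_starProjection_orthogonal_singleton (hφ : ‖φ‖ = 1) (ξ : E) :
    ‖(𝕜 ∙ φ)ᗮ.starProjection ξ‖ ^ 2 = ‖ξ‖ ^ 2 - ‖⟪φ, ξ⟫_𝕜‖ ^ 2 := by
  have h := norm_sq_eq_add_norm_sq_starProjection ξ (𝕜 ∙ φ)
  rw [starProjection_unit_singleton 𝕜 hφ, norm_smul, hφ, mul_one] at h
  linarith

/-- `|⟨φ|ψ⟩| ≤ 1` for unit vectors. [folklore] -/
private theorem norm_inner_le_one {ψ : E} (hφ : ‖φ‖ = 1) (hψ : ‖ψ‖ = 1) : ‖⟪φ, ψ⟫_𝕜‖ ≤ 1 := by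
  simpa [hφ, hψ] using norm_inner_le_norm (𝕜 := 𝕜) φ ψ

end UnitVector

/-! ## Lemma 6.9 -/

section Lemma69

variable {φ ψ : E} {a b c : ℝ}

/-- Unfolding `B` with Pythagoras: `B(ξ) = −b|⟨φ|ξ⟩|² + a|⟨ψ|ξ⟩|² + c(‖ξ‖² − |⟨φ|ξ⟩|²)`.
[cite: ConnesConsani2021, Lemma 6.9 §6.7 p. 28] -/
theorem rankOneForm_eq (hφ : ‖φ‖ = 1) (ξ : E) :
    rankOneForm 𝕜 φ ψ a b c ξ
      = -b * ‖⟪φ, ξ⟫_𝕜‖ ^ 2 + a * ‖⟪ψ, ξ⟫_𝕜‖ ^ 2 + c * (‖ξ‖ ^ 2 - ‖⟪φ, ξ⟫_𝕜‖ ^ 2) := by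
  rw [rankOneForm, norm_sq_starProjection_orthogonal_singleton hφ]

set_option maxHeartbeats 400000 in
/-- **Connes–Consani 2021, Lemma 6.9 — the lower bound `B(ξ) ≥ ε‖ξ‖²`** (arXiv Lemma 42, p. 28),
for unit vectors `φ, ψ` and `a, b, c ≥ 0`, with `ε = rankOneGap a b c |⟨φ|ψ⟩|`.  The source states
it under the positivity conditions; the printed proof (restriction to `span(φ,ψ)`, the `2 × 2`
matrix in the basis `(φ, ψ₂/‖ψ₂‖)`, `B(ξ) = B(ξ₁) + c‖ξ₂‖²`, `ε ≤ c`) gives it for all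
`a, b, c ≥ 0`, and the conditions are exactly `0 ≤ ε` (`rankOneGap_nonneg_iff`).
[cite: ConnesConsani2021, Lemma 6.9 §6.7 p. 28] -/
theorem rankOneGap_mul_norm_sq_le (hφ : ‖φ‖ = 1) (hψ : ‖ψ‖ = 1) (ha : 0 ≤ a) (hb : 0 ≤ b)
    (hc : 0 ≤ c) (ξ : E) :
    rankOneGap a b c ‖⟪φ, ψ⟫_𝕜‖ * ‖ξ‖ ^ 2 ≤ rankOneForm 𝕜 φ ψ a b c ξ := by
  -- notation of the printed proof: `α = ⟨φ|ψ⟩`, `ψ₂ = P_φ ψ`, `β = ‖ψ₂‖`, `t = |α|`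
  set α : 𝕜 := ⟪φ, ψ⟫_𝕜 with hα_def
  set ψ₂ : E := ψ - α • φ with hψ₂_def
  set u : 𝕜 := ⟪φ, ξ⟫_𝕜 with hu_def
  set ξ' : E := ξ - u • φ with hξ'_def
  set t : ℝ := ‖α‖ with ht_def
  set β : ℝ := ‖ψ₂‖ with hβ_def
  have ht0 : 0 ≤ t := norm_nonneg _
  have hβ0 : 0 ≤ β := norm_nonneg _
  -- `‖ψ₂‖² = 1 − |α|²`, `‖ξ'‖² = ‖ξ‖² − |u|²`
  have hβsq : β ^ 2 = 1 - t ^ 2 := by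
    have := norm_sq_starProjection_orthogonal_singleton (𝕜 := 𝕜) hφ ψ
    rwa [starProjection_orthogonal_singleton_apply hφ, hψ, one_pow] at this
  have htβ : t ^ 2 + β ^ 2 = 1 := by linarith
  have hξ'sq : ‖ξ'‖ ^ 2 = ‖ξ‖ ^ 2 - ‖u‖ ^ 2 := by
    have := norm_sq_starProjection_orthogonal_singleton (𝕜 := 𝕜) hφ ξ
    rwa [starProjection_orthogonal_singleton_apply hφ] at this
  -- `⟨ψ|ξ⟩ = conj(α) u + v` with `v = ⟨ψ₂|ξ'⟩`, `|v| ≤ β ‖ξ'‖`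
  set v : 𝕜 := ⟪ψ₂, ξ'⟫_𝕜 with hv_def
  have hψφ : ⟪ψ, φ⟫_𝕜 = starRingEnd 𝕜 α := by rw [hα_def, inner_conj_symm]
  have hφφ : ⟪φ, φ⟫_𝕜 = 1 := by rw [inner_self_eq_norm_sq_to_K, hφ]; simp
  have hv : ⟪ψ, ξ⟫_𝕜 = starRingEnd 𝕜 α * u + v := by
    simp only [hv_def, hψ₂_def, hξ'_def, inner_sub_left, inner_sub_right, inner_smul_left,
      inner_smul_right, hψφ, hφφ, ← hu_def]
    ring
  have hv_le : ‖v‖ ≤ β * ‖ξ'‖ := norm_inner_le_norm ψ₂ ξ'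
  -- `|⟨ψ|ξ⟩|² = t²|u|² + 2 m + |v|²`, `|m| ≤ t |u| |v|`
  set m : ℝ := re ⟪starRingEnd 𝕜 α * u, v⟫_𝕜 with hm_def
  have hnormsq : ‖⟪ψ, ξ⟫_𝕜‖ ^ 2 = t ^ 2 * ‖u‖ ^ 2 + 2 * m + ‖v‖ ^ 2 := by
    rw [hv, norm_add_sq (𝕜 := 𝕜), norm_mul, RCLike.norm_conj, mul_pow, ht_def, hm_def]
  have hm_le : |m| ≤ t * ‖u‖ * ‖v‖ := by
    calc |m| ≤ ‖⟪starRingEnd 𝕜 α * u, v⟫_𝕜‖ := RCLike.abs_re_le_norm _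
      _ ≤ ‖starRingEnd 𝕜 α * u‖ * ‖v‖ := norm_inner_le_norm _ _
      _ = t * ‖u‖ * ‖v‖ := by rw [norm_mul, RCLike.norm_conj, ht_def]
  -- the form, unfolded
  have hB : rankOneForm 𝕜 φ ψ a b c ξ
      = -b * ‖u‖ ^ 2 + a * (t ^ 2 * ‖u‖ ^ 2 + 2 * m + ‖v‖ ^ 2) + c * ‖ξ'‖ ^ 2 := by
    rw [rankOneForm, starProjection_orthogonal_singleton_apply hφ, ← hu_def, ← hξ'_def, hnormsq]
  have hnorm : ‖ξ‖ ^ 2 = ‖u‖ ^ 2 + ‖ξ'‖ ^ 2 := by linarith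
  have hεc : rankOneGap a b c t ≤ c := rankOneGap_le ha hb hc htβ
  rw [hB, hnorm]
  rcases hβ0.eq_or_lt with hβz | hβpos
  · -- degenerate case `ψ₂ = 0` (`ψ` proportional to `φ`): then `v = 0`, `m = 0`
    have hv0 : ‖v‖ = 0 := le_antisymm (by simpa [← hβz] using hv_le) (norm_nonneg _)
    have hm0 : m = 0 := by
      have : |m| ≤ 0 := by simpa [hv0] using hm_le
      exact abs_nonpos_iff.mp this
    have key := core (m := 0) (X := ‖u‖) (Y := ‖ξ'‖) ha hb hc ht0 hβ0 htβ
      (by simpa using mul_nonneg (mul_nonneg ht0 (norm_nonneg u)) (norm_nonneg ξ'))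
    rw [← hβz] at key
    rw [hv0, hm0]
    nlinarith [key]
  · -- generic case: `Y = |v|/β ≤ ‖ξ'‖`, `m = β m'`
    set Y : ℝ := ‖v‖ / β with hY_def
    have hY0 : 0 ≤ Y := div_nonneg (norm_nonneg _) hβ0
    have hYv : β * Y = ‖v‖ := by rw [hY_def]; field_simp
    have hYle : Y ≤ ‖ξ'‖ := by
      rw [hY_def, div_le_iff₀ hβpos]; linarith [hv_le]
    set m' : ℝ := m / β with hm'_def
    have hmm' : β * m' = m := by rw [hm'_def]; field_simp
    have hm'_le : |m'| ≤ t * ‖u‖ * Y := by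
      rw [hm'_def, hY_def, abs_div, abs_of_pos hβpos, div_le_iff₀ hβpos]
      calc |m| ≤ t * ‖u‖ * ‖v‖ := hm_le
        _ = t * ‖u‖ * (‖v‖ / β) * β := by field_simp
    have key := core ha hb hc ht0 hβ0 htβ hm'_le
    -- `‖v‖² = β² Y²`, `2βm' = 2m`; the rest `‖ξ'‖² − Y² ≥ 0` carries the coefficient `c ≥ ε`
    have hvsq : ‖v‖ ^ 2 = β ^ 2 * Y ^ 2 := by rw [← hYv]; ring
    have hrest : 0 ≤ ‖ξ'‖ ^ 2 - Y ^ 2 := by nlinarith [hYle, hY0]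
    rw [hvsq, ← hmm']
    nlinarith [key, mul_le_mul_of_nonneg_right hεc hrest]

/-- **Connes–Consani 2021, Lemma 6.9** (arXiv Lemma 42, p. 28), as printed: for unit vectors `φ, ψ`
of an inner-product space and `a, b, c ≥ 0`, the quadratic form
`B(ξ) = −b|⟨φ|ξ⟩|² + a|⟨ψ|ξ⟩|² + c‖P_φ ξ‖²` is positive (`B(ξ) ≥ 0` for all `ξ`) if and only if
`a + c ≥ b` and `b(a + c) ≤ a(b + c)|⟨φ|ψ⟩|²`.  Proof as printed: "if" from the bound
`B ≥ ε‖·‖²` and `ε ≥ 0`; "only if" by evaluating `B` at `φ` (trace-type condition) and at the vector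
`⟨φ|ψ⟩(a‖ψ₂‖² + c) φ − a|⟨φ|ψ⟩|² ψ₂` of `span(φ, ψ)`, where
`B = |⟨φ|ψ⟩|² (a‖ψ₂‖² + c) · det` (determinant condition). [cite: ConnesConsani2021, Lemma 6.9 §6.7 p. 28] -/
theorem rankOneForm_nonneg_iff (hφ : ‖φ‖ = 1) (hψ : ‖ψ‖ = 1) (ha : 0 ≤ a) (hb : 0 ≤ b)
    (hc : 0 ≤ c) :
    (∀ ξ : E, 0 ≤ rankOneForm 𝕜 φ ψ a b c ξ)
      ↔ b ≤ a + c ∧ b * (a + c) ≤ a * (b + c) * ‖⟪φ, ψ⟫_𝕜‖ ^ 2 := by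
  set α : 𝕜 := ⟪φ, ψ⟫_𝕜 with hα_def
  set ψ₂ : E := ψ - α • φ with hψ₂_def
  set t : ℝ := ‖α‖ with ht_def
  set β : ℝ := ‖ψ₂‖ with hβ_def
  have ht0 : 0 ≤ t := norm_nonneg _
  have hβ0 : 0 ≤ β := norm_nonneg _
  have ht1 : t ≤ 1 := norm_inner_le_one hφ hψ
  have hβsq : β ^ 2 = 1 - t ^ 2 := by
    have := norm_sq_starProjection_orthogonal_singleton (𝕜 := 𝕜) hφ ψ
    rwa [starProjection_orthogonal_singleton_apply hφ, hψ, one_pow] at this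
  have htβ : t ^ 2 + β ^ 2 = 1 := by linarith
  constructor
  · intro h
    -- evaluation at `φ`: `B(φ) = a t² − b ≥ 0`
    have hφφ : ⟪φ, φ⟫_𝕜 = 1 := by rw [inner_self_eq_norm_sq_to_K, hφ]; simp
    have hψφ : ⟪ψ, φ⟫_𝕜 = starRingEnd 𝕜 α := by rw [hα_def, inner_conj_symm]
    have hPφ : (𝕜 ∙ φ)ᗮ.starProjection φ = 0 := by
      rw [starProjection_orthogonal_singleton_apply hφ, hφφ, one_smul, sub_self]
    have h1 : b ≤ a * t ^ 2 := by
      have := h φ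
      rw [rankOneForm, hPφ, hφφ, hψφ, norm_zero, norm_one, RCLike.norm_conj] at this
      nlinarith
    have hcond1 : b ≤ a + c := by nlinarith
    refine ⟨hcond1, ?_⟩
    -- the determinant condition
    rcases ht0.eq_or_lt with htz | htpos
    · -- `t = 0`: then `b = 0`
      have hb0 : b = 0 := le_antisymm (by rw [← htz] at h1; simpa using h1) hb
      rw [hb0]; simp only [zero_mul, zero_add]; positivity
    rcases ha.eq_or_lt with haz | hapos
    · have hb0 : b = 0 := le_antisymm (by rw [← haz] at h1; simpa using h1) hb
      rw [hb0, ← haz]; simp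
    rcases hβ0.eq_or_lt with hβz | hβpos
    · -- `β = 0`, `t = 1`: condition reads `b(a+c) ≤ a(b+c)`, i.e. `bc ≤ ac`, from `b ≤ a`
      have hβ2 : β ^ 2 = 0 := by rw [← hβz]; ring
      have ht1' : t ^ 2 = 1 := by linarith
      rw [ht1'] at h1 ⊢
      nlinarith [mul_le_mul_of_nonneg_right (by linarith : b ≤ a) hc]
    · -- generic case: test vector `ξ₀ = (α k) φ − (a t²) ψ₂`, `k = a β² + c > 0`
      set k : ℝ := a * β ^ 2 + c with hk_def
      have hkpos : 0 < k := by positivity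
      set ξ₀ : E := (α * (k : 𝕜)) • φ - ((a * t ^ 2 : ℝ) : 𝕜) • ψ₂ with hξ₀_def
      have hφψ₂ : ⟪φ, ψ₂⟫_𝕜 = 0 := by
        rw [hψ₂_def, inner_sub_right, inner_smul_right, hφφ, ← hα_def]; ring
      have hψψ₂ : ⟪ψ, ψ₂⟫_𝕜 = ((β ^ 2 : ℝ) : 𝕜) := by
        have hψψ : ⟪ψ, ψ⟫_𝕜 = 1 := by rw [inner_self_eq_norm_sq_to_K, hψ]; simp
        rw [hψ₂_def, inner_sub_right, inner_smul_right, hψψ, hψφ, hβsq, ht_def,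
          RCLike.mul_conj, sq]
        push_cast
        ring
      have hu : ⟪φ, ξ₀⟫_𝕜 = α * (k : 𝕜) := by
        rw [hξ₀_def, inner_sub_right, inner_smul_right, inner_smul_right, hφφ, hφψ₂]; ring
      have hw : ⟪ψ, ξ₀⟫_𝕜 = ((t ^ 2 * c : ℝ) : 𝕜) := by
        rw [hξ₀_def, inner_sub_right, inner_smul_right, inner_smul_right, hψφ, hψψ₂]
        have : α * (k : 𝕜) * starRingEnd 𝕜 α = ((t ^ 2 * k : ℝ) : 𝕜) := by
          rw [mul_comm, ← mul_assoc, RCLike.conj_mul, ← ht_def]; push_cast; ring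
        rw [this, hk_def]; push_cast; ring
      have hP : (𝕜 ∙ φ)ᗮ.starProjection ξ₀ = -(((a * t ^ 2 : ℝ) : 𝕜) • ψ₂) := by
        rw [starProjection_orthogonal_singleton_apply hφ, hu, hξ₀_def]
        abel
      have hval := h ξ₀
      rw [rankOneForm, hu, hw, hP, norm_neg, norm_smul, norm_mul, RCLike.norm_ofReal,
        RCLike.norm_ofReal, RCLike.norm_ofReal, ← ht_def, ← hβ_def, abs_of_pos hkpos,
        abs_of_nonneg (by positivity : (0:ℝ) ≤ t ^ 2 * c),
        abs_of_nonneg (by positivity : (0:ℝ) ≤ a * t ^ 2)] at hval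
      -- `B(ξ₀) = t² k (a(b+c)t² − b(a+c))`
      have hid : -b * (t * k) ^ 2 + a * (t ^ 2 * c) ^ 2 + c * (a * t ^ 2 * β) ^ 2
          = t ^ 2 * k * (a * (b + c) * t ^ 2 - b * (a + c)) := by
        rw [hk_def]; linear_combination (-(a * b * t ^ 2 * (a * β ^ 2 + c))) * hβsq
      rw [hid] at hval
      have hpos : 0 < t ^ 2 * k := by positivity
      have := (mul_nonneg_iff_of_pos_left hpos).mp hval
      linarith
  · rintro ⟨h1, h2⟩ ξ
    have hε : 0 ≤ rankOneGap a b c t := (rankOneGap_nonneg_iff ha hb hc htβ).2 ⟨h1, h2⟩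
    exact (mul_nonneg hε (sq_nonneg _)).trans (rankOneGap_mul_norm_sq_le hφ hψ ha hb hc ξ)

end Lemma69

/-! ## Lemma 6.10: the deduction from the spectral decomposition and `‖𝐊_I − T‖ ≤ ε₁` -/

section Lemma610

variable {K T R : E →L[𝕜] E} {η η₀ : E} {lmax l₂ a ε₁ : ℝ}

/-- The spectral-decomposition step displayed before Lemma 6.9 (p. 28): if
`T = λ_max |η⟩⟨η| + R` with `R ≤ λ₂ P_η` (`P_η` the projection on `η^⊥`, `η` a unit vector), then,
"using `1 = |η⟩⟨η| + P_η`", `⟨ξ|(1 − T)ξ⟩ ≥ (1 − λ_max)|⟨η|ξ⟩|² + (1 − λ₂)‖P_η ξ‖²`.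
[cite: ConnesConsani2021, §6.7 p. 28 (display before Lemma 6.9)] -/
theorem re_inner_sub_ge_of_rankOne_decomposition (hη : ‖η‖ = 1)
    (hT : ∀ ξ, T ξ = ((lmax : ℝ) : 𝕜) • ⟪η, ξ⟫_𝕜 • η + R ξ)
    (hR : ∀ ξ, re ⟪ξ, R ξ⟫_𝕜 ≤ l₂ * ‖(𝕜 ∙ η)ᗮ.starProjection ξ‖ ^ 2) (ξ : E) :
    (1 - lmax) * ‖⟪η, ξ⟫_𝕜‖ ^ 2 + (1 - l₂) * ‖(𝕜 ∙ η)ᗮ.starProjection ξ‖ ^ 2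
      ≤ re ⟪ξ, ξ - T ξ⟫_𝕜 := by
  have hP := norm_sq_starProjection_orthogonal_singleton (𝕜 := 𝕜) hη ξ
  have h2 : ⟪ξ, ((lmax : ℝ) : 𝕜) • ⟪η, ξ⟫_𝕜 • η⟫_𝕜 = ((lmax * ‖⟪η, ξ⟫_𝕜‖ ^ 2 : ℝ) : 𝕜) := by
    rw [inner_smul_right, inner_smul_right, ← inner_conj_symm ξ η, RCLike.mul_conj]
    push_cast; ring
  have h1 : re ⟪ξ, ξ - T ξ⟫_𝕜 = ‖ξ‖ ^ 2 - lmax * ‖⟪η, ξ⟫_𝕜‖ ^ 2 - re ⟪ξ, R ξ⟫_𝕜 := by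
    rw [inner_sub_right, hT ξ, inner_add_right, h2, map_sub, map_add,
      inner_self_eq_norm_sq (𝕜 := 𝕜), RCLike.ofReal_re]
    ring
  rw [h1]
  nlinarith [hR ξ, hP]

/-- **Connes–Consani 2021, Lemma 6.10 — the deduction** (arXiv Lemma 43 and its proof, p. 28),
with every numerical input abstracted into a hypothesis.  Let `η, η₀` be unit vectors,
`T = λ_max|η⟩⟨η| + R` with `R ≤ λ₂ P_η` (`λ_max ≥ 1 ≥ λ₂`), `a ≥ 0`, and `‖K − T‖ ≤ ε₁`.  Then for
all `ξ`, `⟨ξ|(1 − K)ξ⟩ + a|⟨η₀|ξ⟩|² ≥ (ε₂ − ε₁)‖ξ‖²` with `ε₂ = rankOneGap a (λ_max − 1) (1 − λ₂) |⟨η|η₀⟩|`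
(Lemma 6.9 with `φ = η`, `ψ = η₀`, `b = λ_max − 1`, `c = 1 − λ₂`).  In the source this is applied to
`K = 𝐊_I`, the finite-rank `T` of §6.3 and the floating-point values `λ_max = 1.05158`,
`λ₂(T) ≤ 0.772216`, `⟨η₀|η⟩ ≃ 0.94865`, `ε₁ ≃ 0.00122`, `a ≃ 0.064`, `ε₂ ≃ 0.00441`; those inputs are
NOT certified here (nor in print). [cite: ConnesConsani2021, Lemma 6.10 §6.7 p. 28 (proof)] -/
theorem re_inner_sub_le_of_rankOne_decomposition (hη : ‖η‖ = 1) (hη₀ : ‖η₀‖ = 1)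
    (hlmax : 1 ≤ lmax) (hl₂ : l₂ ≤ 1) (ha : 0 ≤ a)
    (hT : ∀ ξ, T ξ = ((lmax : ℝ) : 𝕜) • ⟪η, ξ⟫_𝕜 • η + R ξ)
    (hR : ∀ ξ, re ⟪ξ, R ξ⟫_𝕜 ≤ l₂ * ‖(𝕜 ∙ η)ᗮ.starProjection ξ‖ ^ 2)
    (hKT : ‖K - T‖ ≤ ε₁) (ξ : E) :
    (rankOneGap a (lmax - 1) (1 - l₂) ‖⟪η, η₀⟫_𝕜‖ - ε₁) * ‖ξ‖ ^ 2
      ≤ re ⟪ξ, ξ - K ξ⟫_𝕜 + a * ‖⟪η₀, ξ⟫_𝕜‖ ^ 2 := by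
  -- `⟨ξ|(1 − T)ξ⟩ + a|⟨η₀|ξ⟩|² ≥ B(ξ) ≥ ε₂ ‖ξ‖²`
  have hstep := re_inner_sub_ge_of_rankOne_decomposition hη hT hR ξ
  have hB := rankOneGap_mul_norm_sq_le (𝕜 := 𝕜) hη hη₀ ha (by linarith : 0 ≤ lmax - 1)
    (by linarith : 0 ≤ 1 - l₂) ξ
  rw [rankOneForm] at hB
  -- `|⟨ξ|(K − T)ξ⟩| ≤ ε₁ ‖ξ‖²`
  have hpert : re ⟪ξ, (K - T) ξ⟫_𝕜 ≤ ε₁ * ‖ξ‖ ^ 2 := by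
    calc re ⟪ξ, (K - T) ξ⟫_𝕜 ≤ ‖⟪ξ, (K - T) ξ⟫_𝕜‖ := RCLike.re_le_norm _
      _ ≤ ‖ξ‖ * ‖(K - T) ξ‖ := norm_inner_le_norm _ _
      _ ≤ ‖ξ‖ * (‖K - T‖ * ‖ξ‖) := by gcongr; exact (K - T).le_opNorm ξ
      _ ≤ ‖ξ‖ * (ε₁ * ‖ξ‖) := by gcongr
      _ = ε₁ * ‖ξ‖ ^ 2 := by ring
  have hsplit : re ⟪ξ, ξ - K ξ⟫_𝕜 = re ⟪ξ, ξ - T ξ⟫_𝕜 - re ⟪ξ, (K - T) ξ⟫_𝕜 := by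
    have hKT' : (K - T) ξ = K ξ - T ξ := rfl
    simp only [hKT', inner_sub_right, map_sub]
    ring
  rw [hsplit]
  nlinarith [hstep, hB, hpert]

/-- **The printed conclusion (negativeNI) of Lemma 6.10**: with `N = −2ε′(1₊)(1 − K)` (`ε′(1₊) ≥ 0`)
and `γ = 2aε′(1₊)`, if `ε₁ ≤ ε₂` then `⟨ξ|N ξ⟩ ≤ γ |⟨η₀|ξ⟩|²` for all `ξ` ("which gives
(negativeNI) after multiplication by `−2ε′(1₊)`", p. 28).  Same abstraction as
`re_inner_sub_le_of_rankOne_decomposition`. [cite: ConnesConsani2021, Lemma 6.10 §6.7 p. 28] -/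
theorem re_inner_scaled_le_of_rankOne_decomposition (hη : ‖η‖ = 1) (hη₀ : ‖η₀‖ = 1)
    (hlmax : 1 ≤ lmax) (hl₂ : l₂ ≤ 1) (ha : 0 ≤ a)
    (hT : ∀ ξ, T ξ = ((lmax : ℝ) : 𝕜) • ⟪η, ξ⟫_𝕜 • η + R ξ)
    (hR : ∀ ξ, re ⟪ξ, R ξ⟫_𝕜 ≤ l₂ * ‖(𝕜 ∙ η)ᗮ.starProjection ξ‖ ^ 2)
    (hKT : ‖K - T‖ ≤ ε₁) (hε : ε₁ ≤ rankOneGap a (lmax - 1) (1 - l₂) ‖⟪η, η₀⟫_𝕜‖)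
    {e' : ℝ} (he' : 0 ≤ e') (ξ : E) :
    re ⟪ξ, ((-(2 * e') : ℝ) : 𝕜) • (ξ - K ξ)⟫_𝕜 ≤ 2 * a * e' * ‖⟪η₀, ξ⟫_𝕜‖ ^ 2 := by
  have h := re_inner_sub_le_of_rankOne_decomposition hη hη₀ hlmax hl₂ ha hT hR hKT ξ
  rw [inner_smul_right, RCLike.re_ofReal_mul]
  have h0 : 0 ≤ re ⟪ξ, ξ - K ξ⟫_𝕜 + a * ‖⟪η₀, ξ⟫_𝕜‖ ^ 2 :=
    (mul_nonneg (by linarith) (sq_nonneg _)).trans h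
  nlinarith [h0]

/-- **Arithmetic of the printed constants of Lemma 6.10** (p. 28: "`b ≃ 0.05158`,
`⟨η₀|η⟩ ≃ 0.94865` … `c > 0.227784` … for `a ≃ 0.064`, `ε₂ ≃ 0.00441`", and `ε₁ ≃ 0.00122 < ε₂`):
at the exact decimal values `(a, b, c, t) = (0.064, 0.05158, 0.227784, 0.94865)` both positivity
conditions of Lemma 6.9 hold and `0.00122 < 0.00441 ≤ ε₂`.  This certifies the ARITHMETIC only: the
decimals are floating-point outputs of §6 (Fact 6.1, Fact 6.5, Lemma 6.8), uncertified in print and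
here. [cite: ConnesConsani2021, Lemma 6.10 §6.7 p. 28] -/
theorem printedConstants_posconds :
    (0.05158 : ℝ) ≤ 0.064 + 0.227784 ∧
      (0.05158 : ℝ) * (0.064 + 0.227784) ≤ 0.064 * (0.05158 + 0.227784) * 0.94865 ^ 2 ∧
      (0.00441 : ℝ) ≤ rankOneGap 0.064 0.05158 0.227784 0.94865 ∧
      (0.00122 : ℝ) < 0.00441 := by
  refine ⟨by norm_num, by norm_num, ?_, by norm_num⟩
  unfold rankOneGap
  have hD : ((0.064 : ℝ) + 0.05158 + 0.227784) ^ 2 - 4 * 0.064 * (0.05158 + 0.227784) * 0.94865 ^ 2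
      ≤ (0.064 - 0.05158 + 0.227784 - 2 * 0.00441) ^ 2 := by norm_num
  have hs := (Real.sqrt_le_sqrt hD).trans_eq (Real.sqrt_sq (by norm_num))
  linarith

end Lemma610

/-! ## The spectral decomposition `T = λ_max|η⟩⟨η| + R`, `R ≤ λ₂ P_η` of a self-adjoint `T` (p. 28) -/

section SpectralStep

variable {K T : E →L[𝕜] E} {η η₀ : E} {lmax l₂ a ε₁ : ℝ}

/-- **The decomposition `T = λ_max|η⟩⟨η| + R` of p. 28** from a top eigenpair: if `T η = λ_max η` with
`‖η‖ = 1`, then, "using `1 = |η⟩⟨η| + P_η`", `T ξ = λ_max ⟨η|ξ⟩ η + T(P_η ξ)` for every `ξ`, i.e. the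
shape hypothesis `hT` of `re_inner_sub_le_of_rankOne_decomposition` holds with `R = T ∘ P_η`.
[cite: ConnesConsani2021, §6.7 p. 28 (display (spectraldec))] -/
theorem rankOne_decomposition_of_eigenvector (hη : ‖η‖ = 1) (heig : T η = ((lmax : ℝ) : 𝕜) • η)
    (ξ : E) : T ξ = ((lmax : ℝ) : 𝕜) • ⟪η, ξ⟫_𝕜 • η + T ((𝕜 ∙ η)ᗮ.starProjection ξ) := by
  have hξ : ξ = ⟪η, ξ⟫_𝕜 • η + (𝕜 ∙ η)ᗮ.starProjection ξ := by
    rw [starProjection_orthogonal_singleton_apply hη]; abel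
  conv_lhs => rw [hξ]
  rw [map_add, map_smul, heig, smul_smul, smul_smul, mul_comm]

/-- **`R ≤ λ₂ P_η`** (p. 28: "`R` is …, `R ≤ λ₂ P_η`", `λ₂` the second eigenvalue; "both `T` and `𝐊_I`
are self-adjoint"): if `T` is symmetric (`⟨Tx|y⟩ = ⟨x|Ty⟩`, i.e. `(T : E →ₗ E).IsSymmetric`),
`T η = λ_max η` with `‖η‖ = 1`, and `⟨ζ|Tζ⟩ ≤ λ₂‖ζ‖²` on `η^⊥`, then `R = T ∘ P_η` satisfies
`Re⟨ξ|Rξ⟩ ≤ λ₂ ‖P_η ξ‖²` for every `ξ` — the shape hypothesis `hR` of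
`re_inner_sub_le_of_rankOne_decomposition` (self-adjointness kills the cross term:
`⟨η|T P_η ξ⟩ = ⟨Tη|P_η ξ⟩ = λ_max⟨η|P_η ξ⟩ = 0`). [cite: ConnesConsani2021, §6.7 p. 28 (display (spectraldec))] -/
theorem re_inner_compression_le (hη : ‖η‖ = 1) (hsa : ∀ x y : E, ⟪T x, y⟫_𝕜 = ⟪x, T y⟫_𝕜)
    (heig : T η = ((lmax : ℝ) : 𝕜) • η)
    (hl₂ : ∀ ζ : E, ⟪η, ζ⟫_𝕜 = 0 → re ⟪ζ, T ζ⟫_𝕜 ≤ l₂ * ‖ζ‖ ^ 2) (ξ : E) :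
    re ⟪ξ, T ((𝕜 ∙ η)ᗮ.starProjection ξ)⟫_𝕜 ≤ l₂ * ‖(𝕜 ∙ η)ᗮ.starProjection ξ‖ ^ 2 := by
  set ζ := (𝕜 ∙ η)ᗮ.starProjection ξ with hζ
  have horth : ⟪η, ζ⟫_𝕜 = 0 :=
    mem_orthogonal_singleton_iff_inner_right.1 (starProjection_apply_mem _ ξ)
  have hcross : ⟪η, T ζ⟫_𝕜 = 0 := by
    rw [← hsa, heig, inner_smul_left, horth, mul_zero]
  have hξ : ξ = ⟪η, ξ⟫_𝕜 • η + ζ := by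
    rw [hζ, starProjection_orthogonal_singleton_apply hη]; abel
  have hsplit : ⟪ξ, T ζ⟫_𝕜 = ⟪ζ, T ζ⟫_𝕜 := by
    conv_lhs => rw [hξ]
    rw [inner_add_left, inner_smul_left, hcross, mul_zero, zero_add]
  rw [hsplit]
  exact hl₂ ζ horth

/-- **Lemma 6.10's deduction from the printed spectral data of a self-adjoint `T`** (p. 28): for `T`
symmetric with top eigenpair `T η = λ_max η` (`‖η‖ = 1`, `λ_max ≥ 1`), `⟨ζ|Tζ⟩ ≤ λ₂‖ζ‖²` on `η^⊥`
(`λ₂ ≤ 1`), a unit vector `η₀`, `a ≥ 0` and `‖K − T‖ ≤ ε₁`: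
`⟨ξ|(1 − K)ξ⟩ + a|⟨η₀|ξ⟩|² ≥ (ε₂ − ε₁)‖ξ‖²`, `ε₂ = rankOneGap a (λ_max − 1) (1 − λ₂) |⟨η|η₀⟩|` —
`re_inner_sub_le_of_rankOne_decomposition` with `R = T ∘ P_η` supplied by
`rankOne_decomposition_of_eigenvector` and `re_inner_compression_le`.  In the source `T` is the
finite-rank operator of (opT) (`λ_max = 1.05158` with eigenvector `η = ψ/‖ψ‖`, Lemma 6.4;
`λ₂(T) ≤ 0.772216`, Lemma 6.8 (iii)), `K = 𝐊_I`, `ε₁ ≃ 0.00122` (Fact 6.1 with Lemma 6.3); these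
inputs are NOT certified here. [cite: ConnesConsani2021, Lemma 6.10 §6.7 p. 28 (proof)] -/
theorem re_inner_sub_le_of_selfAdjoint_eigenvector (hη : ‖η‖ = 1) (hη₀ : ‖η₀‖ = 1)
    (hlmax : 1 ≤ lmax) (hl₂ : l₂ ≤ 1) (ha : 0 ≤ a)
    (hsa : ∀ x y : E, ⟪T x, y⟫_𝕜 = ⟪x, T y⟫_𝕜) (heig : T η = ((lmax : ℝ) : 𝕜) • η)
    (hTl₂ : ∀ ζ : E, ⟪η, ζ⟫_𝕜 = 0 → re ⟪ζ, T ζ⟫_𝕜 ≤ l₂ * ‖ζ‖ ^ 2)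
    (hKT : ‖K - T‖ ≤ ε₁) (ξ : E) :
    (rankOneGap a (lmax - 1) (1 - l₂) ‖⟪η, η₀⟫_𝕜‖ - ε₁) * ‖ξ‖ ^ 2
      ≤ re ⟪ξ, ξ - K ξ⟫_𝕜 + a * ‖⟪η₀, ξ⟫_𝕜‖ ^ 2 :=
  re_inner_sub_le_of_rankOne_decomposition (R := T.comp (𝕜 ∙ η)ᗮ.starProjection) hη hη₀ hlmax hl₂
    ha (fun ξ => rankOne_decomposition_of_eigenvector hη heig ξ)
    (fun ξ => re_inner_compression_le hη hsa heig hTl₂ ξ) hKT ξ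

end SpectralStep

end Literature.NumberTheory.ConnesConsani2021

end
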